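import Summits.QuantumAdvantage.AdviceFreeQNC0.SparseOfGap
import Literature.Computability.MetaComplexity.RazborovSmolenskyPoly
import HarnessLib

/-!
# Cell qa-qnc0 (odd primes, route `OddPrimeWalk`, crux `ShotsOdd`): the field-free and algebraic
# PREREQUISITES of the shots rung `WalkHardFShots` — rarely-hit interval, interior surgery, pattern degree

Planner qa-qnc0-p2 g14, `HOME/qa-qnc0-p2/line14/Sketch14p2.lean` §3–§4 / card `LINE-BSHOT.md` (statements
`InteriorHit`, `RarelyHitInterval`, `surgery`, `InteriorSurgery`, `PatternIndicatorDegree` VERBATIM), PROVED: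

* `rarelyHitInterval : RarelyHitInterval` — if every input fires `≤ B` cuts then among the `m` disjoint
  intervals `[kL, (k+1)L)` some interval is INTERIOR-hit on `≤ B·2ⁿ/m` inputs (double counting: an input
  is interior-hit in at most as many intervals as it fires cuts, the interiors being disjoint);
* `interiorSurgery : InteriorSurgery` — switching off every cut strictly inside `[i, i+L)` yields a strategy
  that is cut-free on `[i, i+L)` (`CutFree`, `SparseOfGap.lean`), has the same degree and shot bounds, and the
  same outcome on every input that is not interior-hit;
* `patternIndicatorDegree : PatternIndicatorDegree` — THE algebraic input: with `≤ B` shots per input, the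
  indicator of «the fired set inside `S` is exactly `Y₀`» has `𝔽_p`-degree `≤ B·D`:
  `1_{F(u)=Y₀} = Π_{g∈Y₀} y_g · Π_{g∈S∖Y₀}(1 − y_g) = Σ_{t ⊆ S∖Y₀} (−1)^{|t|} Π_{g ∈ Y₀ ∪ t} y_g`
  (`Finset.prod_add`), and every term with `|Y₀| + |t| > B` is the ZERO FUNCTION (at most `B` of the `y_g`
  are true anywhere), the others have degree `≤ (|Y₀|+|t|)·D ≤ B·D`.

The fibre theorem `WalkHardFGapShots` (§5, = rung R3 with `s ↦ B`, seat qn-prover-3) and the assembly (§6) are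
NOT here.  WHAT THIS IS NOT: no statement about the game's value; `WalkHardF p` OPEN; separation NOT moved.
-/

noncomputable section

namespace Summit.QuantumAdvantage.AdviceFreeQNC0

open Classical
open Finset
open Literature.Computability.MetaComplexity Literature.Computability.MetaComplexity.Smolensky

variable {n : ℕ}

/-! ### Statements (Sketch14p2 §3–§4, verbatim) -/

/-- Input `u` is INTERIOR-HIT in `[i, i+L)` by `y`: some cut strictly inside the interval fires on `u`. -/
def InteriorHit (y : Fin (n + 1) → (Fin n → Bool) → Bool) (i L : ℕ) (u : Fin n → Bool) : Prop :=
  ∃ g : Fin (n + 1), i < g.val ∧ g.val < i + L ∧ y g u = true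

/-- **Rarely-hit interval** (S, field-free double counting): if every input fires ≤ `B` cuts, then among the `m` disjoint
intervals `[kL, (k+1)L)`, `k < m`, `m·L ≤ n`, some interval is interior-hit on at most `B·2ⁿ/m` inputs
(each input is interior-hit in ≤ `B` of them). -/
def RarelyHitInterval : Prop :=
  ∀ (n B m L : ℕ) (y : Fin (n + 1) → (Fin n → Bool) → Bool), 0 < m → m * L ≤ n →
    (∀ u, (univ.filter fun g : Fin (n + 1) => y g u = true).card ≤ B) →
    ∃ k < m, (m : ℝ) * ((univ.filter fun u : Fin n → Bool => InteriorHit y (k * L) L u).card : ℝ)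
      ≤ (B : ℝ) * (2 : ℝ) ^ n

/-- Interior surgery: switch off every cut strictly inside `[i, i+L)`. -/
def surgery (y : Fin (n + 1) → (Fin n → Bool) → Bool) (i L : ℕ) : Fin (n + 1) → (Fin n → Bool) → Bool :=
  fun g u => if i < g.val ∧ g.val < i + L then false else y g u

/-- **Interior surgery** (S): the surgered strategy is cut-free on `[i, i+L)`, has the same degree and shot bounds, and
agrees with `y` on the outcome of every input that is not interior-hit. -/
def InteriorSurgery : Prop :=
  ∀ (p : ℕ) [Fact p.Prime] (n c i L D B : ℕ) (y : Fin (n + 1) → (Fin n → Bool) → Bool),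
    (∀ g, HasDegF p (y g) D) → (∀ u, (univ.filter fun g : Fin (n + 1) => y g u = true).card ≤ B) →
      CutFree i L (surgery y i L) ∧ (∀ g, HasDegF p (surgery y i L g) D) ∧
      (∀ u, (univ.filter fun g : Fin (n + 1) => surgery y i L g u = true).card ≤ B) ∧
      (∀ u, ¬ InteriorHit y i L u → ringWinU c (surgery y i L) u = ringWinU c y u)

/-- **Pattern-indicator degree** (S⁺, the one new algebraic input): for Boolean functions `y g` (`g ∈ S`) of `𝔽_p`-degree
≤ `D` with at most `B` of them true at any input, the indicator of «the fired set is exactly `Y₀`» has degree ≤ `B·D`: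
`1_{F(u)=Y₀} = Σ_{Y₀ ⊆ G ⊆ S, |G| ≤ B} (−1)^{|G∖Y₀|} ∏_{g∈G} y_g(u)` (Möbius inversion of `∏_{g∈G} y_g = 1_{G ⊆ F(u)}`,
the terms with `|G| > B` vanishing pointwise).  For `|Y₀| > B` the indicator is `0`. -/
def PatternIndicatorDegree : Prop :=
  ∀ (p : ℕ) [Fact p.Prime] (n D B : ℕ) (S : Finset (Fin (n + 1))) (y : Fin (n + 1) → (Fin n → Bool) → Bool),
    (∀ g ∈ S, HasDegF p (y g) D) → (∀ u, (S.filter fun g => y g u = true).card ≤ B) →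
    ∀ Y₀ ⊆ S, HasDegF p (fun u => decide (S.filter (fun g => y g u = true) = Y₀)) (B * D)

/-! ### A rarely-hit interval -/

/-- An input is interior-hit in at most as many of the disjoint intervals `[kL, (k+1)L)` as it fires cuts
(a firing interior cut `g` of interval `k` has `(g − 1)/L = k`). -/
private theorem card_hitIntervals_le (m L : ℕ) (y : Fin (n + 1) → (Fin n → Bool) → Bool) (u : Fin n → Bool) :
    ((range m).filter fun k => InteriorHit y (k * L) L u).card ≤
      (univ.filter fun g : Fin (n + 1) => y g u = true).card := by
  have hsub : ((range m).filter fun k => InteriorHit y (k * L) L u) ⊆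
      ((univ.filter fun g : Fin (n + 1) => y g u = true).image fun g => (g.val - 1) / L) := by
    intro k hk
    rw [mem_filter] at hk
    obtain ⟨g, h1, h2, h3⟩ := hk.2
    rw [mem_image]
    refine ⟨g, mem_filter.2 ⟨mem_univ _, h3⟩, ?_⟩
    have e : (k + 1) * L = k * L + L := by ring
    exact Nat.div_eq_of_lt_le (by omega) (by omega)
  exact (card_le_card hsub).trans Finset.card_image_le

/-- **`RarelyHitInterval` — PROVED.** -/
theorem rarelyHitInterval : RarelyHitInterval := by
  intro n B m L y hm _ hB
  -- double counting: `Σ_k #H_k = Σ_u #{k : u ∈ H_k} ≤ Σ_u B = B·2ⁿ`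
  have hsum : ∑ k ∈ range m, ((univ.filter fun u : Fin n → Bool => InteriorHit y (k * L) L u).card) ≤
      B * 2 ^ n := by
    have e : ∑ k ∈ range m, ((univ.filter fun u : Fin n → Bool => InteriorHit y (k * L) L u).card) =
        ∑ u : Fin n → Bool, ((range m).filter fun k => InteriorHit y (k * L) L u).card := by
      simp_rw [Finset.card_filter]
      exact Finset.sum_comm
    rw [e]
    calc ∑ u : Fin n → Bool, ((range m).filter fun k => InteriorHit y (k * L) L u).card
        ≤ ∑ _u : Fin n → Bool, B := sum_le_sum fun u _ => (card_hitIntervals_le m L y u).trans (hB u)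
      _ = B * 2 ^ n := by
          rw [sum_const, card_univ, Fintype.card_fun, Fintype.card_bool, Fintype.card_fin, smul_eq_mul,
            Nat.mul_comm]
  -- the least-hit interval
  obtain ⟨k, hk, hmin⟩ := Finset.exists_min_image (range m)
    (fun k => (univ.filter fun u : Fin n → Bool => InteriorHit y (k * L) L u).card)
    ⟨0, mem_range.2 hm⟩
  refine ⟨k, mem_range.1 hk, ?_⟩
  have hle : m * (univ.filter fun u : Fin n → Bool => InteriorHit y (k * L) L u).card ≤ B * 2 ^ n := by
    calc m * (univ.filter fun u : Fin n → Bool => InteriorHit y (k * L) L u).card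
        = ∑ _k' ∈ range m, (univ.filter fun u : Fin n → Bool => InteriorHit y (k * L) L u).card := by
          rw [sum_const, card_range, smul_eq_mul]
      _ ≤ ∑ k' ∈ range m, (univ.filter fun u : Fin n → Bool => InteriorHit y (k' * L) L u).card :=
          sum_le_sum fun k' hk' => hmin k' hk'
      _ ≤ B * 2 ^ n := hsum
  exact_mod_cast hle

/-! ### Interior surgery -/

/-- **`InteriorSurgery` — PROVED.** -/
theorem interiorSurgery : InteriorSurgery := by
  intro p _ n c i L D B y hdeg hB
  refine ⟨?_, ?_, ?_, ?_⟩
  · -- cut-free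
    intro g hg
    unfold activeCuts at hg
    rw [mem_filter] at hg
    obtain ⟨u, hu⟩ := hg.2
    unfold surgery at hu
    by_cases h : i < g.val ∧ g.val < i + L
    · rw [if_pos h] at hu; exact absurd hu (by simp)
    · omega
  · -- degrees
    intro g
    unfold HasDegF surgery
    by_cases h : i < g.val ∧ g.val < i + L
    · have e : (fun u : Fin n → Bool => if (if i < g.val ∧ g.val < i + L then false else y g u) = true
          then (1 : ZMod p) else 0) = 0 := by
        funext u; simp [h]
      rw [e]; exact Submodule.zero_mem _
    · have e : (fun u : Fin n → Bool => if (if i < g.val ∧ g.val < i + L then false else y g u) = true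
          then (1 : ZMod p) else 0) = fun u => if y g u = true then (1 : ZMod p) else 0 := by
        funext u; simp [h]
      rw [e]; exact hdeg g
  · -- shots
    intro u
    refine le_trans (Finset.card_le_card fun g hg => ?_) (hB u)
    rw [mem_filter] at hg ⊢
    unfold surgery at hg
    by_cases h : i < g.val ∧ g.val < i + L
    · rw [if_pos h] at hg; exact absurd hg.2 (by simp)
    · rw [if_neg h] at hg; exact hg
  · -- same outcome off interior-hit inputs
    intro u hu
    unfold ringWinU
    have hset : (univ.filter fun g : Fin (n + 1) =>
        surgery y i L g u = true ∧ (c + g.val + walkExp u g.val) % 3 ≠ 0) =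
        univ.filter fun g : Fin (n + 1) => y g u = true ∧ (c + g.val + walkExp u g.val) % 3 ≠ 0 := by
      refine filter_congr fun g _ => ?_
      unfold surgery
      by_cases h : i < g.val ∧ g.val < i + L
      · rw [if_pos h]
        have hy : ¬ y g u = true := fun hyg => hu ⟨g, h.1, h.2, hyg⟩
        simp [hy]
      · rw [if_neg h]
    rw [hset]

/-! ### The degree of a firing pattern under a shot bound -/

/-- **`PatternIndicatorDegree` — PROVED.** -/
theorem patternIndicatorDegree : PatternIndicatorDegree := by
  intro p _ n D B S y hdeg hB Y₀ hY₀
  unfold HasDegF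
  -- the `𝔽_p`-indicators
  set yK : Fin (n + 1) → CubeFn (ZMod p) n := fun g u => if y g u = true then (1 : ZMod p) else 0 with hyK
  have hyKdeg : ∀ g ∈ S, yK g ∈ lowDeg (ZMod p) n D := fun g hg => hdeg g hg
  -- pointwise: indicator = Π_{Y₀} y · Π_{S∖Y₀} (1 − y) = Σ_{t ⊆ S∖Y₀} (−1)^{|t|} Π_{Y₀} y · Π_t y
  have hI : (fun u => if decide (S.filter (fun g => y g u = true) = Y₀) = true then (1 : ZMod p) else 0) =
      ∑ t ∈ (S \ Y₀).powerset, ((-1 : ZMod p) ^ t.card) • ((∏ g ∈ Y₀, yK g) * ∏ g ∈ t, yK g) := by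
    funext u
    rw [Finset.sum_apply]
    simp only [Pi.smul_apply, Pi.mul_apply, Finset.prod_apply, smul_eq_mul, hyK, decide_eq_true_eq]
    -- step 1: the indicator as the double product
    have step1 : (if S.filter (fun g => y g u = true) = Y₀ then (1 : ZMod p) else 0) =
        (∏ g ∈ Y₀, (if y g u = true then (1 : ZMod p) else 0)) *
          ∏ g ∈ S \ Y₀, (1 - (if y g u = true then (1 : ZMod p) else 0)) := by
      by_cases hF : S.filter (fun g => y g u = true) = Y₀
      · rw [if_pos hF]
        have h1 : ∀ g ∈ Y₀, y g u = true := fun g hg => by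
          rw [← hF, mem_filter] at hg; exact hg.2
        have h2 : ∀ g ∈ S \ Y₀, ¬ y g u = true := fun g hg hyg => by
          rw [mem_sdiff] at hg
          exact hg.2 (by rw [← hF, mem_filter]; exact ⟨hg.1, hyg⟩)
        rw [Finset.prod_eq_one (fun g hg => by rw [if_pos (h1 g hg)]),
          Finset.prod_eq_one (fun g hg => by rw [if_neg (h2 g hg), sub_zero]), one_mul]
      · rw [if_neg hF]
        -- some `g ∈ S` is misclassified
        have hex : (∃ g ∈ Y₀, ¬ y g u = true) ∨ ∃ g ∈ S \ Y₀, y g u = true := by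
          by_contra hcon
          push Not at hcon
          apply hF
          ext g
          rw [mem_filter]
          constructor
          · rintro ⟨hgS, hyg⟩
            by_contra hgY
            exact (hcon.2 g (mem_sdiff.2 ⟨hgS, hgY⟩)) hyg
          · intro hgY
            exact ⟨hY₀ hgY, by have := hcon.1 g hgY; simpa using this⟩
        rcases hex with ⟨g, hg, hyg⟩ | ⟨g, hg, hyg⟩
        · rw [Finset.prod_eq_zero hg (by rw [if_neg hyg]), zero_mul]
        · rw [Finset.prod_eq_zero hg (by rw [if_pos hyg, sub_self]), mul_zero]
    rw [step1]
    -- step 2: expand `Π (1 − y) = Σ_t (−1)^{|t|} Π_t y`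
    have step2 : ∏ g ∈ S \ Y₀, (1 - (if y g u = true then (1 : ZMod p) else 0)) =
        ∑ t ∈ (S \ Y₀).powerset, (-1 : ZMod p) ^ t.card * ∏ g ∈ t, (if y g u = true then (1 : ZMod p) else 0) := by
      have e : ∀ g ∈ S \ Y₀, (1 - (if y g u = true then (1 : ZMod p) else 0)) =
          (-(if y g u = true then (1 : ZMod p) else 0)) + 1 := fun g _ => by ring
      rw [Finset.prod_congr rfl e, Finset.prod_add]
      refine Finset.sum_congr rfl fun t _ => ?_
      rw [Finset.prod_const_one, mul_one, Finset.prod_neg]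
    rw [step2, Finset.mul_sum]
    refine Finset.sum_congr rfl fun t _ => ?_
    ring
  rw [hI]
  refine Submodule.sum_mem _ fun t ht => Submodule.smul_mem _ _ ?_
  rw [mem_powerset] at ht
  by_cases hsmall : Y₀.card + t.card ≤ B
  · -- genuine term: degree `(|Y₀| + |t|)·D ≤ B·D`
    have h1 : (∏ g ∈ Y₀, yK g) ∈ lowDeg (ZMod p) n (Y₀.card * D) :=
      prod_mem_lowDeg Y₀ fun g hg => hyKdeg g (hY₀ hg)
    have h2 : (∏ g ∈ t, yK g) ∈ lowDeg (ZMod p) n (t.card * D) :=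
      prod_mem_lowDeg t fun g hg => hyKdeg g (mem_sdiff.1 (ht hg)).1
    refine lowDeg_mono ?_ (mul_mem_lowDeg_add h1 h2)
    calc Y₀.card * D + t.card * D = (Y₀.card + t.card) * D := by ring
      _ ≤ B * D := Nat.mul_le_mul_right _ hsmall
  · -- a term with more than `B` factors is the zero function
    have hzero : (∏ g ∈ Y₀, yK g) * (∏ g ∈ t, yK g) = 0 := by
      funext u
      rw [Pi.mul_apply, Pi.zero_apply, Finset.prod_apply, Finset.prod_apply]
      simp only [hyK]
      rw [Finset.prod_boole, Finset.prod_boole]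
      by_cases h1 : ∀ g ∈ Y₀, y g u = true
      · by_cases h2 : ∀ g ∈ t, y g u = true
        · exfalso
          -- all of `Y₀ ∪ t` fire: more than `B` shots
          have hsub : Y₀ ∪ t ⊆ S.filter fun g => y g u = true := by
            intro g hg
            rw [mem_union] at hg
            rw [mem_filter]
            rcases hg with hg | hg
            · exact ⟨hY₀ hg, h1 g hg⟩
            · exact ⟨(mem_sdiff.1 (ht hg)).1, h2 g hg⟩
          have hdisj : Disjoint Y₀ t := by
            rw [Finset.disjoint_left]
            intro g hg hgt
            exact (mem_sdiff.1 (ht hgt)).2 hg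
          have := (Finset.card_le_card hsub).trans (hB u)
          rw [Finset.card_union_of_disjoint hdisj] at this
          omega
        · rw [if_neg h2, mul_zero]
      · rw [if_neg h1, zero_mul]
    rw [hzero]
    exact Submodule.zero_mem _

end Summit.QuantumAdvantage.AdviceFreeQNC0

end
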